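import Summits.BirchSwinnertonDyer.Rank1Residual.GaloisImage.KuriharaLowerBoundThreeOfTransport
import Summits.BirchSwinnertonDyer.Rank1Residual.GaloisImage.KatoKuriharaPortThreeWith
import Summits.BirchSwinnertonDyer.Rank1Residual.GaloisImage.KuriharaLowerBoundThreeAt
import HarnessLib

/-!
# P-KEYED twin of `KuriharaLowerBoundThreeOfTransport` — the two-level dictionary hypothesis `hdict` AT ONE PARAMETRISATION DATUM `P`
# (cell `b2b-bsdres`, team n1011; T-PORT-FIX (lead R5-112 (a) / R5-113 (a), joint text (ii-b)): the repaired
# port PORT″ `KatoKuriharaPortThreeAtWith₂ W t v₃ η P` unpacks to `KatoKuriharaDictionaryThreeAt₂At … P`, so the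
# lower-bound chain below the record corollary is re-keyed by ONE binder; seat p03 GEN 13 — BANKED bytes
# offered to the T-PORT-FIX owner n1011-p18, filed only on the owner's / lead's word)

HONEST FRAMING (cell `b2b-bsdres`, run/shared/lean/b2b/bsd-rank1-residual/, verbatim in every
file): the goal of the cell is to DELETE the COMBINATION-SHAPED residual classes of the
Birch–Swinnerton-Dyer formula for ALL analytic-rank `≤ 1` elliptic curves over `ℚ` — "full BSD
formula for every rank `≤ 1` curve in class `C`" assembled STRICTLY from published theorems — so
that the rank-`≤ 1` remainder becomes exactly the CONSTRUCTION-SHAPED classes, which are TYPED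
(missing-input `Prop`s), NOT attempted. This is not "finishing BSD". Team n1011 (N10/N11, the
additive block `X4 ∧ p = 3`): research route; no claim beyond the stated classes; the label X4 and
the mark of RESIDUAL-MAP §I N11 are UNCHANGED by this file; nothing is booked.  TOOL theorems only
(no definition, no named fact); CONDITIONAL exactly as `KuriharaLowerBoundThreeOfTransport.lean` EXCEPT that the two-level
dictionary hypothesis is the `P`-keyed `KatoKuriharaDictionaryThreeAt₂At W t k k′ D D′ red v₃ P`
(n1011-p18's PORT″ append to `GaloisImage/KatoKuriharaPortThreeWith.lean`, joint text of lead R5-112 (a)):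
binder diff EXACTLY {{`hdict : … KatoKuriharaDictionaryThreeAt₂ … v₃`}} ↦
{{`hdict : … KatoKuriharaDictionaryThreeAt₂At … v₃ P`}} at the theorem's own `P` (which already precedes
`hdict` in the signature); the ONE application `hdict … hv₃ P hcP hper` loses its `P`; every call into the
chain is re-pointed to the `_at` twin below; every other token is the original.  WHY: the universal-closure
PORT was shown UNSATISFIABLE on its population (n1011-p11 GEN 11, T-PORT-NEG p326481; r1 GEN 47 / referee-1
GEN 48 CONFIRMED); the repair displays ONE generator family `η` AND keys the dictionary at the record's own
parametrisation datum `P` so that its NAMED DISCHARGER (★ PK-6₂) reaches it with no lemma the tree lacks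
(DESIGN CRITERION OF RECORD, R5-112 (a)).  The original `∀ P` theorems stay (parents: `….at P`).

References: as `KuriharaLowerBoundThreeOfTransport.lean`; cells/n1011/PLAN.md R5-110 / R5-112 / R5-113; ROUTE-1.md §59–§60.
-/

noncomputable section

open scoped Classical NumberField ContRepresentation
open Function NumberField IsDedekindDomain WeierstrassCurve
  Literature.NumberTheory.EllipticCurves Literature.NumberTheory.EllipticCurves.ModularForms
  Literature.NumberTheory.EllipticCurves.Rank1Residual
  Literature.NumberTheory.GaloisRepresentations
  Literature.NumberTheory.GaloisRepresentations.DiscreteGaloisModule Literature.NumberTheory.GaloisCohomology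

namespace Summit.BirchSwinnertonDyer.Rank1Residual.GaloisImage.Assembly

/-- **P-KEYED twin of `padicValRat_le_of_certificate_of_transport` (T-PORT-FIX, joint text (ii-b) of lead R5-112 (a) / R5-113 (a)):** binder diff EXACTLY {`hdict : … KatoKuriharaDictionaryThreeAt₂ … v₃`} ↦ {`hdict : … KatoKuriharaDictionaryThreeAt₂At … v₃ P`} at this theorem's own `P`; conclusion and every other binder identical; the original docstring follows verbatim.
**(C20) at `p = 3` in datum currency, transport and level counts discharged — the END THEOREM
of sub-route (a′) modulo the dictionary (PORT), the [S24] (1)(2) instances at every level of the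
shallow and deep data, the Poitou–Tate families and `hEP`** (module docstring; (B6): on `t = 1`
rows supply `D ⊆ 𝒫_{k+1+t}`, `D′ ⊆ 𝒫_{k′+1+t}`).
[cite: Kim2022StructureSelmer, Thm. 1.9 (6) and Thm. 3.13] [cite: Sakamoto2024, Thm. 4.4 (p. 926)]
[cite: MazurRubin2004, Thm. 3.2.4, Thm. 4.4.1 and App. A (33)] -/
theorem padicValRat_le_of_certificate_of_transport_at
    (W : WeierstrassCurve ℚ) [W.IsElliptic] [W.IsGloballyMinimal] (t k : ℕ)
    (D : KolyvaginDatum (W.torsionGaloisModule (((3 : ℕ) : ℤ) ^ k * ((3 : ℕ) : ℤ))))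
    (v₃ : HeightOneSpectrum (𝓞 ℚ)) (hv₃ : ((3 : ℕ) : 𝓞 ℚ) ∈ v₃.asIdeal)
    -- the row
    (hadd : Addv W 3) (hc3 : ¬ 3 ∣ (W.baseChange ℚ_[3]).localTamagawaNumber ℤ_[3])
    (hsurj : W.HasSurjectiveModNGaloisRep ((3 : ℕ) : ℤ))
    (ht : Nat.card {Q : (W.baseChange ℚ_[3]).toAffine.Point // (3 : ℕ) • Q = 0} = 3 ^ t)
    (hL : W.entireLFunction 1 ≠ 0) [Finite W.toAffine.Point] [Finite W.sha]
    {N : ℕ} [NeZero N] (P : ModularParametrizationData W N) (hcP : ¬ ((3 : ℕ) : ℤ) ∣ P.maninConstant)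
    (hper : ∃ u : ℚ, ‖(u : ℚ_[3])‖ = 1 ∧ W.realPeriodRat = u * plusPeriod P.f)
    -- the shallow datum: cyclotomic transverse condition, a generator `g` of `KS₁`, and Sakamoto's
    -- Thm. 4.4 (2) in ORDER form at every level (R1-22 instance)
    (hDT : D.transverse = cyclotomicTransverse _)
    (g : Finset (HeightOneSpectrum (𝓞 ℚ)) →
      galoisCohomology (W.torsionGaloisModule (((3 : ℕ) : ℤ) ^ k * ((3 : ℕ) : ℤ))) 1)
    (hg : g ∈ D.kolyvaginSystems (propagatedSelmerStructure W 3 k))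
    (hgen : ∀ κ ∈ D.kolyvaginSystems (propagatedSelmerStructure W 3 k), ∃ a : ℕ, κ = a • g)
    -- the deep inputs, at every depth `k′`
    (D' : ∀ k' : ℕ, KolyvaginDatum (W.torsionGaloisModule (((3 : ℕ) : ℤ) ^ k' * ((3 : ℕ) : ℤ))))
    (hDT' : ∀ k', (D' k').transverse = cyclotomicTransverse _)
    (hPP' : ∀ k', (D' k').primes ⊆ D.primes)
    (red : ∀ k' : ℕ, (W.torsionGaloisModule (((3 : ℕ) : ℤ) ^ k' * ((3 : ℕ) : ℤ))).toContRepresentation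
      →ⁱL (W.torsionGaloisModule (((3 : ℕ) : ℤ) ^ k * ((3 : ℕ) : ℤ))).toContRepresentation)
    (hred : ∀ k', ∀ x : geomTorsion W (((3 : ℕ) : ℤ) ^ k' * ((3 : ℕ) : ℤ)),
      ((red k' x : geomTorsion W (((3 : ℕ) : ℤ) ^ k * ((3 : ℕ) : ℤ))) : geomPoints W) =
        (((3 : ℕ) : ℤ) ^ (k' - k)) • (x : geomPoints W))
    (hdict : ∀ k', k ≤ k' → KatoKuriharaDictionaryThreeAt₂At W t k k' D (D' k') (red k') v₃ P)
    (g' : ∀ k' : ℕ, Finset (HeightOneSpectrum (𝓞 ℚ)) →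
      galoisCohomology (W.torsionGaloisModule (((3 : ℕ) : ℤ) ^ k' * ((3 : ℕ) : ℤ))) 1)
    (hg' : ∀ k', g' k' ∈ (D' k').kolyvaginSystems (propagatedSelmerStructure W 3 k'))
    (hgo' : ∀ k', addOrderOf (g' k') = 3 ^ (k' + 1))
    (hgen' : ∀ k', ∀ κ ∈ (D' k').kolyvaginSystems (propagatedSelmerStructure W 3 k'),
      ∃ a : ℕ, κ = a • g' k')
    (inv' : ∀ k' : ℕ, LocalInvariants ℚ (3 ^ (k' + 1))) (hperf' : ∀ k', (inv' k').IsPerfect)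
    (hsum' : ∀ k', (inv' k').SumLocalTermEqZero) (hcompl' : ∀ k', (inv' k').SelmerComplement)
    (hinj' : ∀ k', ∀ v : HeightOneSpectrum (𝓞 ℚ), Injective (inv' k' (Sum.inr v)))
    (hEP : ∀ v : HeightOneSpectrum (𝓞 ℚ), localEulerPoincareCharacteristic (v.adicCompletion ℚ))
    (T : ∀ k' : ℕ, Finset (HeightOneSpectrum (𝓞 ℚ))) (hv₃T : ∀ k', v₃ ∈ T k')
    (hT : ∀ k', ∀ v : HeightOneSpectrum (𝓞 ℚ), v ∉ T k' →
      (((3 ^ (k' + 1) : ℕ) : ℕ) : 𝓞 ℚ) ∉ v.asIdeal ∧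
        GaloisRep.IsUnramifiedAt v (W.torsionGaloisModule (((3 : ℕ) : ℤ) ^ k' * ((3 : ℕ) : ℤ))))
    (h𝓕T : ∀ k', (propagatedSelmerStructure W 3 k').IsUnramifiedOutside (finSupport (T k')))
    (h𝓚T : ∀ k', (W.kummerSelmerStructure (((3 : ℕ) : ℤ) ^ k' * ((3 : ℕ) : ℤ))).IsUnramifiedOutside
      (finSupport (T k')))
    (hfinT : ∀ k', Finite (geomTorsion W (((3 : ℕ) : ℤ) ^ k' * ((3 : ℕ) : ℤ))))
    (hfinS : ∀ k', Finite (W.kummerSelmerStructure (((3 : ℕ) : ℤ) ^ k' * ((3 : ℕ) : ℤ))).selmerGroup)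
    -- the primes of the data lie off the admissible sets and have Rubin's local shape
    (hPS : ∀ q ∈ D.primes, q ∉ T k) (hPS' : ∀ k', ∀ q ∈ (D' k').primes, q ∉ T k')
    (hUT : ∀ q ∈ D.primes,
      Nat.card (unramifiedSubgroup (GaloisRep.toLocal q
        (W.torsionGaloisModule (((3 : ℕ) : ℤ) ^ k * ((3 : ℕ) : ℤ)))) 1) =
        Nat.card (D.transverse (Sum.inr q)))
    (hUT' : ∀ k', ∀ q ∈ (D' k').primes,
      Nat.card (unramifiedSubgroup (GaloisRep.toLocal q
        (W.torsionGaloisModule (((3 : ℕ) : ℤ) ^ k' * ((3 : ℕ) : ℤ)))) 1) =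
        Nat.card ((D' k').transverse (Sum.inr q)))
    -- Sakamoto's Thm. 4.4 (2) in ORDER form at every level, shallow and deep (R1-22 / S24-DEEP)
    (hR22D : ∀ d, D.IsLevel d →
      (Nat.card ((inv' k).dualSelmerStructure _
          (D.atLevel (propagatedSelmerStructure W 3 k) d)).selmerGroup ∣ 3 ^ (k + 1) →
        addOrderOf (g d) * Nat.card ((inv' k).dualSelmerStructure _
          (D.atLevel (propagatedSelmerStructure W 3 k) d)).selmerGroup = 3 ^ (k + 1)) ∧
      (3 ^ (k + 1) ∣ Nat.card ((inv' k).dualSelmerStructure _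
          (D.atLevel (propagatedSelmerStructure W 3 k) d)).selmerGroup → g d = 0))
    (hR22' : ∀ k' d, (D' k').IsLevel d →
      (Nat.card ((inv' k').dualSelmerStructure _
          ((D' k').atLevel (propagatedSelmerStructure W 3 k') d)).selmerGroup ∣ 3 ^ (k' + 1) →
        addOrderOf (g' k' d) * Nat.card ((inv' k').dualSelmerStructure _
          ((D' k').atLevel (propagatedSelmerStructure W 3 k') d)).selmerGroup = 3 ^ (k' + 1)) ∧
      (3 ^ (k' + 1) ∣ Nat.card ((inv' k').dualSelmerStructure _
          ((D' k').atLevel (propagatedSelmerStructure W 3 k') d)).selmerGroup → g' k' d = 0))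
    -- the certificate at a level `n` of `D`
    (n : Finset (HeightOneSpectrum (𝓞 ℚ))) (hn : D.IsLevel n) {j : ℕ} (htj : t + j ≤ k + 1)
    (hPN : ∀ q ∈ n, (Ideal.absNorm q.asIdeal).Coprime N)
    {ψ₀ : (ℓ : ℕ) → (ZMod ℓ)ˣ →* Multiplicative (ZMod (3 ^ j))}
    (hψ₀ : ∀ q ∈ n, Function.Surjective (ψ₀ (Ideal.absNorm q.asIdeal)))
    (hcert : haveI : NeZero (∏ q ∈ n, Ideal.absNorm q.asIdeal) :=
        ⟨Finset.prod_ne_zero_iff.2 fun q _ => absNorm_ne_zero q⟩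
      kuriharaNumber P.f (3 ^ j) (∏ q ∈ n, Ideal.absNorm q.asIdeal) ψ₀ ≠ 0)
    (hv : ∀ c, c ⊂ n → c.Nonempty → ∀ ψ' : (ℓ : ℕ) → (ZMod ℓ)ˣ →* Multiplicative (ZMod (3 ^ j)),
      (∀ q ∈ c, Function.Surjective (ψ' (Ideal.absNorm q.asIdeal))) →
        haveI : NeZero (∏ q ∈ c, Ideal.absNorm q.asIdeal) :=
          ⟨Finset.prod_ne_zero_iff.2 fun q _ => absNorm_ne_zero q⟩
        kuriharaNumber P.f (3 ^ j) (∏ q ∈ c, Ideal.absNorm q.asIdeal) ψ' = 0) :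
    ∃ q : ℚ, W.entireLFunction 1 / (W.realPeriodRat : ℂ) = (q : ℂ) ∧
      padicValRat 3 q ≤
        (padicValNat 3 (Nat.card (AddCommGroup.primaryComponent W.sha 3)) : ℤ) + ((j - 1 : ℕ) : ℤ) := by
  haveI : Fact (Nat.Prime 3) := ⟨Nat.prime_three⟩
  -- `hR22` at the empty level is the case `d = ∅` of `hR22'`
  have hR22 : ∀ k', (Nat.card ((inv' k').dualSelmerStructure
          (W.torsionGaloisModule (((3 : ℕ) : ℤ) ^ k' * ((3 : ℕ) : ℤ)))
          (propagatedSelmerStructure W 3 k')).selmerGroup ∣ 3 ^ (k' + 1) →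
        addOrderOf (g' k' ∅) * Nat.card ((inv' k').dualSelmerStructure
          (W.torsionGaloisModule (((3 : ℕ) : ℤ) ^ k' * ((3 : ℕ) : ℤ)))
            (propagatedSelmerStructure W 3 k')).selmerGroup = 3 ^ (k' + 1)) ∧
      (3 ^ (k' + 1) ∣ Nat.card ((inv' k').dualSelmerStructure
          (W.torsionGaloisModule (((3 : ℕ) : ℤ) ^ k' * ((3 : ℕ) : ℤ)))
            (propagatedSelmerStructure W 3 k')).selmerGroup → g' k' ∅ = 0) := by
    intro k'
    have h := hR22' k' ∅ (D' k').isLevel_empty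
    have h0 : (D' k').atLevel (propagatedSelmerStructure W 3 k') ∅ =
        propagatedSelmerStructure W 3 k' := SelmerStructure.modify_empty _ _
    rw [h0] at h
    exact h
  -- `hNp`: the dual Selmer group of `𝓕_can` is a finite `3`-group
  have hNp : ∀ k', ∃ l, Nat.card ((inv' k').dualSelmerStructure
      (W.torsionGaloisModule (((3 : ℕ) : ℤ) ^ k' * ((3 : ℕ) : ℤ)))
        (propagatedSelmerStructure W 3 k')).selmerGroup = 3 ^ l := by
    intro k'
    haveI := hfinT k'
    haveI := hfinS k'
    haveI : NeZero (3 ^ (k' + 1)) := ⟨pow_ne_zero _ three_ne_zero⟩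
    have hKSD := DeepLedger.natCard_selmerGroup_kummer_eq_dual_of_eq W
      (((3 : ℕ) : ℤ) ^ k' * ((3 : ℕ) : ℤ)) (3 ^ (k' + 1)) (by push_cast; ring)
      (Nat.prime_three.isPrimePow.pow (Nat.succ_ne_zero k')) ((by decide : Odd 3).pow)
      (inv' k') (hinj' k') hEP
    have hfinKd : Finite ((inv' k').dualSelmerStructure
        (W.torsionGaloisModule (((3 : ℕ) : ℤ) ^ k' * ((3 : ℕ) : ℤ)))
        (W.kummerSelmerStructure (((3 : ℕ) : ℤ) ^ k' * ((3 : ℕ) : ℤ)))).selmerGroup :=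
      Nat.finite_of_card_ne_zero (by rw [← hKSD]; exact Nat.card_pos.ne')
    have hsub := (inv' k').selmerGroup_dualSelmerStructure_anti
      (W.torsionGaloisModule (((3 : ℕ) : ℤ) ^ k' * ((3 : ℕ) : ℤ)))
      (𝓕 := W.kummerSelmerStructure (((3 : ℕ) : ℤ) ^ k' * ((3 : ℕ) : ℤ)))
      (𝓖 := propagatedSelmerStructure W 3 k')
      (fun v => kummerSelmerStructure_le_propagatedSelmerStructure W 3 v k')
    haveI : Finite ((inv' k').dualSelmerStructure
        (W.torsionGaloisModule (((3 : ℕ) : ℤ) ^ k' * ((3 : ℕ) : ℤ)))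
        (propagatedSelmerStructure W 3 k')).selmerGroup :=
      Finite.of_injective (AddSubgroup.inclusion hsub) (AddSubgroup.inclusion_injective hsub)
    exact Transport.exists_natCard_eq_pow_of_nsmul_eq_zero (p := 3) (K := k' + 1) fun x =>
      Subtype.ext (by
        rw [AddSubmonoidClass.coe_nsmul, ZeroMemClass.coe_zero]
        exact galoisCohomology.nsmul_eq_zero_of_forall _
          (fun f => DiscreteGaloisModule.TateDual.nsmul_eq_zero f) x.1)
  -- `htr`: p11's scalar transport, its pair counts supplied by the level counts at the two depths
  have htr : ∀ k', k ≤ k' → ∀ (κ' : Finset (HeightOneSpectrum (𝓞 ℚ)) →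
        galoisCohomology (W.torsionGaloisModule (((3 : ℕ) : ℤ) ^ k * ((3 : ℕ) : ℤ))) 1)
      (κu' : Finset (HeightOneSpectrum (𝓞 ℚ)) →
        galoisCohomology (W.torsionGaloisModule (((3 : ℕ) : ℤ) ^ k' * ((3 : ℕ) : ℤ))) 1)
      (a a' : ℕ), κ' ∈ D.kolyvaginSystems (propagatedSelmerStructure W 3 k) →
        κu' ∈ (D' k').kolyvaginSystems (propagatedSelmerStructure W 3 k') →
        κ' = a • g → κu' = a' • g' k' →
        (∀ d, (D' k').IsLevel d → D.IsLevel d → galoisCohomology.map (red k') 1 (κu' d) = κ' d) →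
        ∀ s, s ≤ k + 1 → (3 ^ s ∣ a ↔ 3 ^ s ∣ a') := by
    intro k' hk' κ' κu' a a' _ _ hκ' hκu' hcomp
    haveI := hfinT k
    haveI := hfinT k'
    haveI := hfinS k
    haveI := hfinS k'
    -- the `Λ`-clauses at the two depths, from the two-level dictionary
    obtain ⟨κ₀, Λ, κ₀', κu₀, Λu, κu₀', hWk, hWk', -⟩ :=
      hdict k' hk' hk' (hred k') hadd hc3 hsurj ht hv₃ hcP hper
    obtain ⟨-, -, hon, hker, -⟩ := hWk
    obtain ⟨-, -, hon', hker', -⟩ := hWk'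
    have hPT : ∀ d, D.IsLevel d →
        Nat.card (D.atLevel (propagatedSelmerStructure W 3 k) d).selmerGroup =
          3 ^ (k + 1) * Nat.card ((inv' k).dualSelmerStructure _
            (D.atLevel (propagatedSelmerStructure W 3 k) d)).selmerGroup := fun d hd =>
      DeepLedger.natCard_selmerGroup_propagated_atLevel_eq W 3 k (by norm_num) hv₃ Λ hon hker
        (inv' k) (hperf' k) (hsum' k) (hcompl' k) (hinj' k) hEP (T k) (hv₃T k) (hT k) (h𝓕T k)
        (h𝓚T k) D hPS hUT hd
    have hPT' : ∀ d, (D' k').IsLevel d →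
        Nat.card ((D' k').atLevel (propagatedSelmerStructure W 3 k') d).selmerGroup =
          3 ^ (k' + 1) * Nat.card ((inv' k').dualSelmerStructure _
            ((D' k').atLevel (propagatedSelmerStructure W 3 k') d)).selmerGroup := fun d hd =>
      DeepLedger.natCard_selmerGroup_propagated_atLevel_eq W 3 k' (by norm_num) hv₃ Λu hon' hker'
        (inv' k') (hperf' k') (hsum' k') (hcompl' k') (hinj' k') hEP (T k') (hv₃T k') (hT k')
        (h𝓕T k') (h𝓚T k') (D' k') (hPS' k') (hUT' k') hd
    exact Transport.pow_dvd_iff_of_comp W hk' D (D' k') (red k') (hred k') hsurj hDT (hDT' k')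
      (hPP' k') (inv' k) (inv' k') hg (hg' k') (hgo' k') hR22D (hR22' k') hPT hPT' hκ' hκu' hcomp
  exact padicValRat_le_of_certificate_at W t k D v₃ hv₃ hadd hc3 hsurj ht hL P hcP hper g hgen D' red
    hred hdict g' hg' hgen' inv' hperf' hsum' hcompl' hinj' hEP T hv₃T hT h𝓕T h𝓚T hfinT hfinS hR22
    hNp htr n hn htj hPN hψ₀ hcert hv

end Summit.BirchSwinnertonDyer.Rank1Residual.GaloisImage.Assembly

end
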